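import Literature.Probability.RandomPlanarGeometry.ShellTraversalNet
import Literature.Probability.RandomPlanarGeometry.SAWRestrictionCovariance
import Literature.Probability.RandomPlanarGeometry.PolylineShellTraversals
import Literature.Probability.RandomPlanarGeometry.CurveTortuosity
import Literature.Probability.LatticeModels.MeshDomainJordan
import Literature.Probability.LatticeModels.LatticeDobrushinDomain
import HarnessLib

/-!
# `EventualTight`, line `Sketch`: one aspect ratio carries the bulk leaf

Crux item `stmt-CriticalPhenomena-1372` (`SAWRenewalTightness.EventualTight`), line `Sketch`
(registration v7), stub `stub_aspectReduction` (A).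

Per-shell tightness of the number of separate traversals
(`Curve.HasTraversals j y η R`, `Literature/Probability/RandomPlanarGeometry/CurveTortuosity.lean`)
of the critical SAW polyline on the interior shells of ASPECT TWO `D(y; η, 2η)` with collar
`B̄(y, 4η) ⊆ Ω` (hypothesis) gives it on every interior shell `D(y; η, R)`, `0 < η < R`, with
collar `B̄(y, 2R) ⊆ Ω` (conclusion: the child item `BulkShellTight`).

Proof.
* Wide shells (`2η ≤ R`): `j` traversals of `D(y; η, R)` are `j` traversals of `D(y; η, 2η)`
  (`Curve.HasTraversals.mono'`), and `B̄(y, 4η) ⊆ B̄(y, 2R) ⊆ Ω`; `measure_mono`.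
* Thin shells (in fact any `η < R`): middle radius `m := (η + R)/2`, half-width
  `R' := (R − η)/2`, a net of `M` points `Nᵢ = y + m e^{i(−π + 2πi/M)}` on the circle
  `|z − y| = m` of resolution `ρ := 2πm/M < R'/4`.  The collar of each small shell is interior:
  `B̄(Nᵢ, 4ρ) ⊆ B̄(y, m + 4ρ) ⊆ B̄(y, 2R) ⊆ Ω`, so the hypothesis at `(Nᵢ, ρ, ε/M)` gives
  thresholds `jᵢ` and mesh bounds `δᵢ`.  The net localization with thresholds
  `Curve.exists_net_hasTraversals_of_hasTraversals` (`ShellTraversalNet.lean`) turns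
  `Σ_{i<M} jᵢ` separate traversals of `D(y; η, R)` into `jᵢ` separate traversals of
  `D(Nᵢ; ρ, R' − ρ)`, hence of `D(Nᵢ; ρ, 2ρ)` (`Curve.HasTraversals.mono'`, `3ρ ≤ R'`), for some
  `i < M`; the union bound over the net gives `P_δ[Σ jᵢ traversals] ≤ M · ε/M = ε` for
  `δ ≤ min δᵢ`.

Folklore plane geometry around the Aizenman–Burchard regularity criterion (the one-dimensional
net variant of the covering argument of AB99 Lemma 3.1).
[cite: AizenmanBurchardDuke1999, §1.b and Lemma 3.1]
-/

noncomputable section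

open MeasureTheory Filter Topology Set Metric
open scoped ENNReal NNReal unitInterval Real
open Literature.Probability.RandomPlanarGeometry Literature.Probability.LatticeModels

namespace Summit.CriticalPhenomena.SAWScalingLimit.Theorems

/-- **Aspect reduction for bulk shell tightness.**  If, for every Dobrushin domain with an
endpoint approximation, every interior shell of aspect two `D(y; η, 2η)` with `B̄(y, 4η) ⊆ Ω` and
every `ε > 0`, some threshold `j` and mesh bound `δ₁ > 0` give
`P_δ[j separate traversals of D(y; η, 2η)] ≤ ε` for `δ ∈ (0, δ₁]`, then the same holds for every
interior shell `D(y; η, R)`, `0 < η < R`, `B̄(y, 2R) ⊆ Ω`.  Wide shells by monotonicity of the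
traversal event in the outer radius; thin shells by a finite net on the middle circle, the net
localization `Curve.exists_net_hasTraversals_of_hasTraversals` and a union bound (see the module
docstring). [cite: AizenmanBurchardDuke1999, §1.b and Lemma 3.1] -/
theorem stub_aspectReduction :
    (∀ (D : DobrushinDomain) (a b : ℝ → Site 2), SAW.IsEndpointApprox D a b →
      ∀ (y : ℂ) (η : ℝ), 0 < η → Metric.closedBall y (4 * η) ⊆ D.carrier →
        ∀ ε : ℝ, 0 < ε → ∃ (j : ℕ) (δ₁ : ℝ), 0 < δ₁ ∧ ∀ δ ∈ Set.Ioc (0 : ℝ) δ₁,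
          SAW.law D.carrier δ (a δ) (b δ)
            {γ | (⟨γ.walk.toCurve (meshPoint δ)⟩ : Curve ℂ).HasTraversals j y η (2 * η)} ≤ ENNReal.ofReal ε) →
    ∀ (D : DobrushinDomain) (a b : ℝ → Site 2), SAW.IsEndpointApprox D a b →
      ∀ (y : ℂ) (η R : ℝ), 0 < η → η < R → Metric.closedBall y (2 * R) ⊆ D.carrier →
        ∀ ε : ℝ, 0 < ε → ∃ (j : ℕ) (δ₁ : ℝ), 0 < δ₁ ∧ ∀ δ ∈ Set.Ioc (0 : ℝ) δ₁,
          SAW.law D.carrier δ (a δ) (b δ)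
            {γ | (⟨γ.walk.toCurve (meshPoint δ)⟩ : Curve ℂ).HasTraversals j y η R} ≤ ENNReal.ofReal ε := by
  intro hA D a b hab y η R hη hηR hcol ε hε
  classical
  rcases le_or_gt (2 * η) R with hwide | _hthin
  · /- wide shells: the event only shrinks when the outer radius grows -/
    have hcol' : closedBall y (4 * η) ⊆ D.carrier :=
      (closedBall_subset_closedBall (by linarith)).trans hcol
    obtain ⟨j, δ₁, hδ₁, hb⟩ := hA D a b hab y η hη hcol' ε hε
    refine ⟨j, δ₁, hδ₁, fun δ hδ => le_trans (measure_mono fun γ hγ => ?_) (hb δ hδ)⟩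
    exact Curve.HasTraversals.mono' hγ le_rfl hwide
  · /- thin shells (the argument below does not use `R < 2η`): a net on the middle circle -/
    -- (1) radii
    set m : ℝ := (η + R) / 2 with hm_def
    set R' : ℝ := (R - η) / 2 with hR'_def
    have hmpos : 0 < m := by rw [hm_def]; linarith
    have hR' : 0 < R' := by rw [hR'_def]; linarith
    -- (2) resolution and size of the net
    set ρ₀ : ℝ := R' / 4 with hρ₀_def
    have hρ₀ : 0 < ρ₀ := by rw [hρ₀_def]; positivity
    set M : ℕ := ⌈2 * π * m / ρ₀⌉₊ + 1 with hM_def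
    have hM1 : 1 ≤ M := by omega
    have hMpos : (0 : ℝ) < M := by exact_mod_cast (show 0 < M by omega)
    have hMgt : 2 * π * m / ρ₀ < M := by
      have h1 := Nat.le_ceil (2 * π * m / ρ₀)
      have h2 : (M : ℝ) = (⌈2 * π * m / ρ₀⌉₊ : ℝ) + 1 := by rw [hM_def]; push_cast; ring
      rw [h2]
      linarith
    set ρ : ℝ := 2 * π * m / M with hρ_def
    have hρ : 0 < ρ := by rw [hρ_def]; positivity
    have hρρ₀ : ρ < ρ₀ := by
      rw [hρ_def, div_lt_iff₀ hMpos]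
      have h1 := (div_lt_iff₀ hρ₀).1 hMgt
      linarith [mul_comm (M : ℝ) ρ₀]
    have h3ρ : 2 * ρ ≤ R' - ρ := by rw [hρ₀_def] at hρρ₀; linarith
    -- (3) the net points and their collars
    let N : ℕ → ℂ := fun i => y + (m : ℂ) * Complex.exp (((-π + 2 * π * i / M : ℝ) : ℂ) * Complex.I)
    have hNdist : ∀ i, dist (N i) y = m := fun i => by
      show dist (y + (m : ℂ) * Complex.exp (((-π + 2 * π * i / M : ℝ) : ℂ) * Complex.I)) y = m
      rw [dist_eq_norm, add_sub_cancel_left, norm_mul, Complex.norm_real, Real.norm_eq_abs,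
        abs_of_nonneg hmpos.le, Complex.norm_exp_ofReal_mul_I, mul_one]
    have hcolN : ∀ i, closedBall (N i) (4 * ρ) ⊆ D.carrier := fun i => by
      refine (closedBall_subset_closedBall' ?_).trans hcol
      rw [hNdist i]
      have h4 : 4 * ρ ≤ R' := by linarith
      rw [hR'_def] at h4
      rw [hm_def]
      linarith
    -- (4) the hypothesis at each net point
    set ε' : ℝ := ε / M with hε'_def
    have hε' : 0 < ε' := div_pos hε hMpos
    have key : ∀ i : ℕ, ∃ (j : ℕ) (δi : ℝ), 0 < δi ∧ ∀ δ ∈ Set.Ioc (0 : ℝ) δi,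
        SAW.law D.carrier δ (a δ) (b δ)
          {γ | (⟨γ.walk.toCurve (meshPoint δ)⟩ : Curve ℂ).HasTraversals j (N i) ρ (2 * ρ)} ≤
          ENNReal.ofReal ε' :=
      fun i => hA D a b hab (N i) ρ hρ (hcolN i) ε' hε'
    choose j δi hδi hbound using key
    -- (5) thresholds, net localization and the union bound
    haveI : NeZero M := ⟨by omega⟩
    set δ₁ : ℝ := Finset.univ.inf' Finset.univ_nonempty (fun i : Fin M => δi i) with hδ₁_def
    have hδ₁ : 0 < δ₁ := (Finset.lt_inf'_iff _).2 fun i _ => hδi i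
    have hδ₁le : ∀ i : Fin M, δ₁ ≤ δi i := fun i =>
      Finset.inf'_le (fun i : Fin M => δi i) (Finset.mem_univ i)
    refine ⟨∑ i ∈ Finset.range M, j i, δ₁, hδ₁, fun δ hδ => ?_⟩
    -- the event inclusion
    have hsubev : {γ : SAW.DomainSAW D.carrier δ (a δ) (b δ) |
          (⟨γ.walk.toCurve (meshPoint δ)⟩ : Curve ℂ).HasTraversals
            (∑ i ∈ Finset.range M, j i) y η R} ⊆
        ⋃ i : Fin M,
          {γ | (⟨γ.walk.toCurve (meshPoint δ)⟩ : Curve ℂ).HasTraversals (j i) (N i) ρ (2 * ρ)} := by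
      intro γ hγ
      obtain ⟨i, hiM, htrav⟩ :=
        Curve.exists_net_hasTraversals_of_hasTraversals hη.le hηR hM1 j hγ
      refine Set.mem_iUnion.2 ⟨⟨i, hiM⟩, ?_⟩
      exact htrav.mono' le_rfl h3ρ
    calc SAW.law D.carrier δ (a δ) (b δ) {γ : SAW.DomainSAW D.carrier δ (a δ) (b δ) |
            (⟨γ.walk.toCurve (meshPoint δ)⟩ : Curve ℂ).HasTraversals
              (∑ i ∈ Finset.range M, j i) y η R}
        ≤ SAW.law D.carrier δ (a δ) (b δ) (⋃ i : Fin M,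
            {γ | (⟨γ.walk.toCurve (meshPoint δ)⟩ : Curve ℂ).HasTraversals (j i) (N i) ρ (2 * ρ)}) :=
          measure_mono hsubev
      _ ≤ ∑ i : Fin M, SAW.law D.carrier δ (a δ) (b δ)
            {γ | (⟨γ.walk.toCurve (meshPoint δ)⟩ : Curve ℂ).HasTraversals (j i) (N i) ρ (2 * ρ)} :=
          measure_iUnion_fintype_le _ _
      _ ≤ ∑ _i : Fin M, ENNReal.ofReal ε' :=
          Finset.sum_le_sum fun i _ => hbound i δ ⟨hδ.1, hδ.2.trans (hδ₁le i)⟩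
      _ = ENNReal.ofReal (M * ε') := by
          rw [Finset.sum_const, Finset.card_univ, Fintype.card_fin, nsmul_eq_mul,
            ENNReal.ofReal_mul (Nat.cast_nonneg M), ENNReal.ofReal_natCast]
      _ = ENNReal.ofReal ε := by
          congr 1
          rw [hε'_def]
          field_simp

end Summit.CriticalPhenomena.SAWScalingLimit.Theorems

end
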